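/-
Origin: expansion seat `prover-pub-hodgecm-mc-binder-2-g14-0`, handover #R3 2026-08-20T11:00Z md5 68952aa39497 (PKG f3cfb865ceb1 → 68952aa39497; 444 l.; arms `locIdx/locFam/locWt((−n,n))/locFam_span/locFam_eigen/vacExp/coe_pinnedVac/locGen(:= genSigma lam δ α n₂ n₁)/locGen_locFam`; NEW `omega_sigmaSwap_locFam`, `locFreq_sigmaSwap`, `locGen_sigmaSwap_apply`) (`HOME/mc/pub-hodgecm-mc-binder-2/g14/t12/HodgeCM/PerL34/FockPrintTorusOrbit.lean`, md5 68952aa39497, 444 lines);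
landed by the second packager p2 gen 7 (p2-g7) in gate run 50 REPLACES the earlier landed copy of `HodgeCM/PerL34/FockPrintTorusOrbit.lean` (seat copy carried the packager Origin header of an earlier run (stripped)).
-/
/-
# pub-hodgecm · seat pv12-g9 · leaf 2: the TORUS directions of the seam-S4 smoothness field `smooth` / `hF`,
# DISCHARGED (KERNEL) for the printed places of PerL Lemma 4.1 with pinned vacuum characters

STATUS: KERNEL throughout (zero cited facts, zero hypotheses beyond the binders named below); additive leaf; imports the
tree files `HodgeCM.PerL34.FockTorusOrbitDeriv` (this seat's leaf 1) and `HodgeCM.PerL34.PrintedTorusMatch` (pv11-g8) plus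
three Mathlib files.  Namespace `HodgeCM.PerL34.Fock.PrintDict` (new names only; no instance, no global simp set).
WHAT IT PROVES.  Fix the printed place data of Lemma 4.1 — real places `RP`, kinds `kind : RP → PlaceKind` (`Σ₁₂`, `D₁₂`,
`ι₁`), scales `λ_b ≠ 0` — and the PINNED vacuum characters `pinnedVacs kind m₁ m₂` of the consumed end state (pv11-g8/g9
`PrintedLinEndState`, `PrintedOpEndState`, `LinSmoothSide`; ENDSTATE-S4-SPEC.md §1), so that the archimedean Fock datum is
`pl := printPlaces RP kind λ hλ (pinnedVacs kind m₁ m₂)` (pv12-g7), `𝓕^κ_∞ = pl.F = ⊗_b 𝓕^{κ_b}_b`, place torus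
`T(L₀ ⊗ ℝ) = pl.Tg = Π_b U(1) × U(1)`.  For every torus velocity `(α, δ) : RP → ℝ × ℝ` let `torusCurve α δ : ℝ → pl.Tg`,
`s ↦ (e^{iα_b s}, e^{iδ_b s})_b`, and let `torusGen α δ : pl.F →ₗ[ℂ] pl.F` be the EXPLICIT operator `Σ_b slot_b (locGen_b)`
(pv12-g2 `Fock.slot`): at `b ∈ Σ₁₂`, `locGen_b = iα_b·ρ(1⊗E₀₀)|_M + iδ_b·ρ(1⊗E₁₁)|_M + i(δ_b(3/2 − m₂ b) − α_b(3/2 + m₁ b))·1`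
(`genSigma`; `ρ(1⊗E_{aa})|_M = printedU11M λ_b (a,a)`, pv12-g6/g7 — the PRINTED compact generators of PerL ll. 392–396); at
`b ∈ D₁₂ ∪ {ι₁}`, `locGen_b = −i(m₁ b·α_b + m₂ b·δ_b)·1`.  THEN (`tendsto_slope_omg_torus`): for ANY type `G`, ANY topological
ℂ-vector space `SK`, ANY `omg : G → SK → SK`, ANY `ιT : pl.Tg → G`, ANY linear `ins : pl.F →ₗ[ℂ] SK` with the [SETUP D4]
equivariance `omg (ιT t) (ins φ) = ins (pl.ωT t φ)` (the field `omg_ins` of `FockAnalyticBridge` / `LinOrbitSide` /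
`LinSmoothSide`) and ANY curve `e` with `e s = ιT (torusCurve α δ s)`, EVERY `φ ∈ pl.F` satisfies
  `Tendsto (fun s ↦ (s:ℂ)⁻¹ • (omg (e s) (ins φ) − omg (e 0) (ins φ))) (𝓝[≠] 0) (𝓝 (ins (torusGen α δ φ)))`,
i.e. the `smooth` clause of pv11-g9 `LinSmoothSide` (tree `PrintedSmoothEndState.lean` l. 180) for the index `j = (α, δ)`
with `XR j := torusGen α δ`, `e j := ιT ∘ torusCurve α δ` — verbatim ONCE `SK`'s topology is a vector-space topology
(instances `IsTopologicalAddGroup SK`, `ContinuousSMul ℂ SK`; `LinSmoothSide` / `IsolationCore` carry a BARE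
`[TopologicalSpace SK]`, and without any compatibility the clause is unprovable for trivial reasons, e.g. the discrete
topology; on the end state `SK = 𝒮^κ ⊂ S(X_A)` they are the TVS axioms of Weil's topology, [We64 n° 11], a property of the
constructed model [SETUP D4], not supplied here); and (`hasDerivAt_apply_omg_torus`) the `hF` shape of `LinOrbitSide` /
`FockAnalyticBridge` after any ℂ-linear observation `Λ` into a normed space — NO topology on `SK` at all (for
`Λ = pointFunctionalₗ` this is the torus part of `hF` given the two linearity laws of `Φ ↦ 𝒯_Φ`).  Proof: leaf 1 + the spanning
eigenfamilies `P^n` (at `Σ₁₂`), all of `ℂ·1` (at `D₁₂`), all of `ℂ·det z` (at `ι₁`) with their circle-monomial characters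
(pv12-g7 `ofPrintMCircle_omega_P_pow`, `ofPrintECircle_omega`, `ofPrintICircle_ω_apply`, pv11-g8 `coe_circleZPow`) + Mathlib
`PiTensorProduct.submodule_span_eq_top` + the printed eigenvalues `torusW₀_P_pow`, `torusW₁_P_pow` (pv12-g6).
WHAT IT DOES NOT PROVE (honest scope; GAPS.md pv12g9-1, pv12g9-2).  (i) Only TORUS directions: the ℂ-span of the operators
`torusGen α δ` contains, per `b ∈ Σ₁₂`, the slots of `ρ(1⊗E₀₀)|_M`, `ρ(1⊗E₁₁)|_M` modulo scalars, but NOT the raising /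
lowering slots `ρ(1⊗E₀₁)|_M = (i/λ)P·`, `ρ(1⊗E₁₀)|_M = iλΣ∂∂` (pv12-g6 `fockOp_rho_raiseW/lowerW`), which change the
`P`-degree; so `ladder_span` / `gen` are NOT served by torus directions (cf. pv06-g7 `ArchCHyperbolic`: one hyperbolic direction
per `Σ₁₂` place serves `gen`, torus directions are not needed — here: they are free).  (ii) The bridge binders `omg, ιT, ins,
omg_ins` are hypotheses, as in every end-state structure; nothing is said about `dense`.  (iii) Consequently the O14-R
print warrant (Poulsen 1972 / Folland 1989 / Reed–Simon I) is load-bearing ONLY for non-torus real directions.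
-/
import Summits.HodgeConjecture.HodgeCM.PerL34.FockTorusOrbitDeriv
import Summits.HodgeConjecture.HodgeCM.PerL34.PrintedTorusMatch_2
import Mathlib.LinearAlgebra.PiTensorProduct.Generators
import Mathlib.Analysis.SpecialFunctions.ExpDeriv
import Mathlib.Analysis.Complex.Circle

noncomputable section

open Filter Topology Complex
open scoped BigOperators TensorProduct

namespace HodgeCM
namespace PerL34
namespace Fock
namespace PrintDict

/-! ## 1. One-parameter subgroups of `U(1) × U(1)` and the derivative of a circle monomial along them -/

/-- The one-parameter curve `s ↦ (e^{iαs}, e^{iδs})` in `U(1) × U(1)` with velocity `(α, δ)`. -/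
def circleCurve (α δ : ℝ) (s : ℝ) : Circle × Circle := (Circle.exp (α * s), Circle.exp (δ * s))

/-- (Ported verbatim from the HodgeCMPerL package; no docstring in the source.) -/
@[simp] theorem circleCurve_zero (α δ : ℝ) : circleCurve α δ 0 = 1 := by
  simp [circleCurve, Circle.exp_zero, Prod.one_eq_mk]

/-- (Ported verbatim from the HodgeCMPerL package; no docstring in the source.) -/
theorem circleCurve_fst_coe (α δ : ℝ) (s : ℝ) :
    (((circleCurve α δ s).1 : Circle) : ℂ) = Complex.exp ((s : ℂ) * (I * α)) := by
  rw [circleCurve, Circle.coe_exp]; push_cast; ring_nf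

/-- (Ported verbatim from the HodgeCMPerL package; no docstring in the source.) -/
theorem circleCurve_snd_coe (α δ : ℝ) (s : ℝ) :
    (((circleCurve α δ s).2 : Circle) : ℂ) = Complex.exp ((s : ℂ) * (I * δ)) := by
  rw [circleCurve, Circle.coe_exp]; push_cast; ring_nf

/-- The circle monomial `u ↦ u₁^a u₂^b` (`a, b ∈ ℤ`) along the curve is `s ↦ exp(s · i(aα + bδ))`. -/
theorem circleMonomial_circleCurve (α δ : ℝ) (a b : ℤ) (s : ℝ) :
    (((circleCurve α δ s).1 : Circle) : ℂ) ^ a * (((circleCurve α δ s).2 : Circle) : ℂ) ^ b =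
      Complex.exp ((s : ℂ) * (I * (a * α + b * δ))) := by
  rw [circleCurve_fst_coe, circleCurve_snd_coe, ← Complex.exp_int_mul, ← Complex.exp_int_mul, ← Complex.exp_add]
  congr 1; ring

/-- (Ported verbatim from the HodgeCMPerL package; no docstring in the source.) -/
theorem hasDerivAt_cexp_mul_const (θ : ℂ) :
    HasDerivAt (fun s : ℝ => Complex.exp ((s : ℂ) * θ)) θ 0 := by
  have h := ((hasDerivAt_id (0 : ℝ)).ofReal_comp.mul_const θ).cexp
  simpa using h

/-- **(KERNEL)** `d/ds|₀ (u₁(s)^a u₂(s)^b) = i(aα + bδ)` along `circleCurve α δ`. -/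
theorem hasDerivAt_circleMonomial (α δ : ℝ) (a b : ℤ) :
    HasDerivAt (fun s : ℝ => (((circleCurve α δ s).1 : Circle) : ℂ) ^ a * (((circleCurve α δ s).2 : Circle) : ℂ) ^ b)
      (I * (a * α + b * δ)) 0 := by
  have h := hasDerivAt_cexp_mul_const (I * (a * α + b * δ))
  refine h.congr_of_eventuallyEq (Filter.Eventually.of_forall fun s => ?_)
  exact circleMonomial_circleCurve α δ a b s

/-! ## 2. Per place type: a spanning family of torus eigenvectors of the printed κ-part, with monomial weights -/

section Local

variable (lam : ℂ) (hlam : lam ≠ 0) (vac : Circle × Circle →* Circle)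

/-- Index of the spanning eigenfamily of the printed κ-part of kind `k`: the exponents `n` of `P^n` at `Σ₁₂`; at
`D₁₂` / `ι₁` the κ-part is a line on which the torus is scalar, so EVERY vector is an eigenvector (index = the part). -/
def locIdx : PlaceKind → Type
  | .sigma => ℕ
  | .delta => ↥kappaPartE
  | .iota => ↥kappaPartI
  | .sigmaSwap => ℕ

/-- The spanning eigenfamily: `P^n` at `Σ₁₂`, the identity family at `D₁₂` / `ι₁`. -/
def locFam : (k : PlaceKind) → locIdx k → (printLoc lam hlam vac k).M
  | .sigma => fun n : ℕ => (⟨P ^ n, P_pow_mem_kappaPartM n⟩ : ↥kappaPartM)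
  | .delta => fun φ : ↥kappaPartE => φ
  | .iota => fun φ : ↥kappaPartI => φ
  | .sigmaSwap => fun n : ℕ => (⟨P ^ n, P_pow_mem_kappaPartM n⟩ : ↥kappaPartM)

/-- The polynomial torus weight `(p, q)` of a family member (`u ↦ u₁^p u₂^q`): `(n, −n)` for `P^n` (`scalePi_P_pow`),
`(0, 0)` on the constants at `D₁₂`, `(1, 1)` = `det` on `ℂ·det z` at `ι₁` (`ofPrintICircle_χ`); `(−n, n)` for `P^n` at a
swapped `Σ₁₂` place (T12: `z` is scaled by `u₂`, `w` by `u₁⁻¹`). -/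
def locWt : (k : PlaceKind) → locIdx k → ℤ × ℤ
  | .sigma => fun n : ℕ => ((n : ℤ), -(n : ℤ))
  | .delta => fun _ => (0, 0)
  | .iota => fun _ => (1, 1)
  | .sigmaSwap => fun n : ℕ => (-(n : ℤ), (n : ℤ))

/-- (Ported verbatim from the HodgeCMPerL package; no docstring in the source.) -/
theorem locFam_span : ∀ k : PlaceKind, Submodule.span ℂ (Set.range (locFam lam hlam vac k)) = ⊤
  | .sigma => by
    show Submodule.span ℂ (Set.range fun n : ℕ => (⟨P ^ n, P_pow_mem_kappaPartM n⟩ : ↥kappaPartM)) = ⊤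
    apply Submodule.map_injective_of_injective kappaPartM.injective_subtype
    rw [Submodule.map_span, Submodule.map_top, Submodule.range_subtype, ← Set.range_comp]
    rfl
  | .delta => by
    show Submodule.span ℂ (Set.range fun φ : ↥kappaPartE => φ) = ⊤
    rw [Set.range_id', Submodule.span_univ]
  | .iota => by
    show Submodule.span ℂ (Set.range fun φ : ↥kappaPartI => φ) = ⊤
    rw [Set.range_id', Submodule.span_univ]
  | .sigmaSwap => by
    show Submodule.span ℂ (Set.range fun n : ℕ => (⟨P ^ n, P_pow_mem_kappaPartM n⟩ : ↥kappaPartM)) = ⊤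
    apply Submodule.map_injective_of_injective kappaPartM.injective_subtype
    rw [Submodule.map_span, Submodule.map_top, Submodule.range_subtype, ← Set.range_comp]
    rfl

/-- At `Σ₁₂` (KERNEL, `ofPrintMCircle_omega_P_pow`): `ω(u) P^n = vac(u) u₁^n u₂^{-n} P^n`. -/
theorem omega_sigma_locFam (u : Circle × Circle) (n : ℕ) :
    (printLoc lam hlam vac .sigma).ω ((kindCoord lam hlam vac .sigma).symm u) (locFam lam hlam vac .sigma n) =
      (((vac u : Circle) : ℂ) * (((u.1 : Circle) : ℂ) ^ (n : ℤ) * ((u.2 : Circle) : ℂ) ^ (-(n : ℤ)))) •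
        locFam lam hlam vac .sigma n := by
  show (LocalFock.ofPrintMCircle lam hlam (fun t => ((vac t : Circle) : ℂ))).ω u ⟨P ^ n, P_pow_mem_kappaPartM n⟩ =
      (((vac u : Circle) : ℂ) * (((u.1 : Circle) : ℂ) ^ (n : ℤ) * ((u.2 : Circle) : ℂ) ^ (-(n : ℤ)))) •
        (⟨P ^ n, P_pow_mem_kappaPartM n⟩ : ↥kappaPartM)
  apply Subtype.ext
  have h := LocalFock.ofPrintMCircle_omega_P_pow (fun t => ((vac t : Circle) : ℂ)) u n
  rw [Submodule.coe_smul]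
  refine h.trans ?_
  simp only [zpow_neg, zpow_natCast, mul_pow, inv_pow]

/-- At `D₁₂` (KERNEL, `ofPrintECircle_omega`): `ω(u) φ = vac(u) φ` on the whole line. -/
theorem omega_delta_locFam (u : Circle × Circle) (φ : ↥kappaPartE) :
    (printLoc lam hlam vac .delta).ω ((kindCoord lam hlam vac .delta).symm u) (locFam lam hlam vac .delta φ) =
      (((vac u : Circle) : ℂ) * (((u.1 : Circle) : ℂ) ^ (0 : ℤ) * ((u.2 : Circle) : ℂ) ^ (0 : ℤ))) •
        locFam lam hlam vac .delta φ := by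
  show ((((vac u : Circle) : ℂ)) • (scalePiE (circleUnits u)).toLinearMap.restrict
      (scalePiE_mem_kappaPartE (circleUnits u))) φ = _ • φ
  refine (LocalFock.ofPrintECircle_omega (fun t => ((vac t : Circle) : ℂ)) u φ).trans ?_
  simp only [zpow_zero, mul_one]
  rfl

/-- At `ι₁` (KERNEL, `ofPrintICircle_ω_apply` / `_χ`): `ω(u) φ = vac(u) u₁u₂ φ` on the whole line `ℂ·det z`. -/
theorem omega_iota_locFam (u : Circle × Circle) (φ : ↥kappaPartI) :
    (printLoc lam hlam vac .iota).ω ((kindCoord lam hlam vac .iota).symm u) (locFam lam hlam vac .iota φ) =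
      (((vac u : Circle) : ℂ) * (((u.1 : Circle) : ℂ) ^ (1 : ℤ) * ((u.2 : Circle) : ℂ) ^ (1 : ℤ))) •
        locFam lam hlam vac .iota φ := by
  show (LocalFock.ofPrintICircle lam fun t => ((vac t : Circle) : ℂ)).ω u φ = _ • φ
  rw [LocalFock.ofPrintICircle_ω_apply, LocalFock.ofPrintICircle_χ, zpow_one, zpow_one]
  rfl

/-- At a swapped `Σ₁₂` place (T12; KERNEL, `ofPrintMCircleSwap_omega_P_pow`): `ω(u) P^n = vac(u) u₁^{-n} u₂^{n} P^n`. -/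
theorem omega_sigmaSwap_locFam (u : Circle × Circle) (n : ℕ) :
    (printLoc lam hlam vac .sigmaSwap).ω ((kindCoord lam hlam vac .sigmaSwap).symm u) (locFam lam hlam vac .sigmaSwap n) =
      (((vac u : Circle) : ℂ) * (((u.1 : Circle) : ℂ) ^ (-(n : ℤ)) * ((u.2 : Circle) : ℂ) ^ (n : ℤ))) •
        locFam lam hlam vac .sigmaSwap n := by
  show (LocalFock.ofPrintMCircleSwap lam hlam (fun t => ((vac t : Circle) : ℂ))).ω u ⟨P ^ n, P_pow_mem_kappaPartM n⟩ =
      (((vac u : Circle) : ℂ) * (((u.1 : Circle) : ℂ) ^ (-(n : ℤ)) * ((u.2 : Circle) : ℂ) ^ (n : ℤ))) •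
        (⟨P ^ n, P_pow_mem_kappaPartM n⟩ : ↥kappaPartM)
  apply Subtype.ext
  have h := LocalFock.ofPrintMCircleSwap_omega_P_pow (fun t => ((vac t : Circle) : ℂ)) u n
  rw [Submodule.coe_smul]
  refine h.trans ?_
  simp only [zpow_neg, zpow_natCast, mul_pow, inv_pow, mul_comm (((u.2 : Circle) : ℂ) ^ n)]

/-- **Eigen-lemma (KERNEL)**: the printed torus of kind `k` acts on each family member by `vac u · u₁^p u₂^q`. -/
theorem locFam_eigen : ∀ (k : PlaceKind) (i : locIdx k) (u : Circle × Circle),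
    (printLoc lam hlam vac k).ω ((kindCoord lam hlam vac k).symm u) (locFam lam hlam vac k i) =
      (((vac u : Circle) : ℂ) * (((u.1 : Circle) : ℂ) ^ (locWt k i).1 * ((u.2 : Circle) : ℂ) ^ (locWt k i).2)) •
        locFam lam hlam vac k i := by
  intro k
  cases k with
  | sigma => exact fun n u => omega_sigma_locFam lam hlam vac u n
  | delta => exact fun φ u => omega_delta_locFam lam hlam vac u φ
  | iota => exact fun φ u => omega_iota_locFam lam hlam vac u φ
  | sigmaSwap => exact fun n u => omega_sigmaSwap_locFam lam hlam vac u n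

end Local

/-! ## 3. Pinned vacuum characters: total weights, frequencies, and the local generators in PRINTED form -/

section Pinned

variable (lam : ℂ) (hlam : lam ≠ 0)

/-- The exponents of the pinned vacuum character `pinnedVac k n₁ n₂ = (u ↦ u₁^a u₂^b)` (pv11-g8 `PrintedTorusMatch`):
`(−n₁, −n₂)` at `Σ₁₂` / `D₁₂`, `(−n₁−1, −n₂−1)` at `ι₁`. -/
def vacExp : PlaceKind → ℤ → ℤ → ℤ × ℤ
  | .sigma, n₁, n₂ => (-n₁, -n₂)
  | .delta, n₁, n₂ => (-n₁, -n₂)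
  | .iota, n₁, n₂ => (-n₁ - 1, -n₂ - 1)
  | .sigmaSwap, n₁, n₂ => (-n₁, -n₂)

/-- (Ported verbatim from the HodgeCMPerL package; no docstring in the source.) -/
theorem coe_pinnedVac : ∀ (k : PlaceKind) (n₁ n₂ : ℤ) (u : Circle × Circle),
    ((pinnedVac k n₁ n₂ u : Circle) : ℂ) =
      ((u.1 : Circle) : ℂ) ^ (vacExp k n₁ n₂).1 * ((u.2 : Circle) : ℂ) ^ (vacExp k n₁ n₂).2
  | .sigma, n₁, n₂, u => coe_circleZPow (-n₁) (-n₂) u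
  | .delta, n₁, n₂, u => coe_circleZPow (-n₁) (-n₂) u
  | .iota, n₁, n₂, u => coe_circleZPow (-n₁ - 1) (-n₂ - 1) u
  | .sigmaSwap, n₁, n₂, u => coe_circleZPow (-n₁) (-n₂) u

/-- The TOTAL torus weight of the family member `i` of kind `k` under the pinned datum (vacuum + polynomial). -/
def totExp (k : PlaceKind) (n₁ n₂ : ℤ) (i : locIdx k) : ℤ × ℤ :=
  ((vacExp k n₁ n₂).1 + (locWt k i).1, (vacExp k n₁ n₂).2 + (locWt k i).2)

/-- The character of the pinned printed torus of kind `k` on the family member `i`, along `circleCurve α δ`. -/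
def locChar (k : PlaceKind) (n₁ n₂ : ℤ) (α δ : ℝ) (i : locIdx k) (s : ℝ) : ℂ :=
  ((pinnedVac k n₁ n₂ (circleCurve α δ s) : Circle) : ℂ) *
    ((((circleCurve α δ s).1 : Circle) : ℂ) ^ (locWt k i).1 * (((circleCurve α δ s).2 : Circle) : ℂ) ^ (locWt k i).2)

/-- Its FREQUENCY `i(a α + b δ)`, `(a, b)` the total weight: the eigenvalue of the infinitesimal generator. -/
def locFreq (k : PlaceKind) (n₁ n₂ : ℤ) (α δ : ℝ) (i : locIdx k) : ℂ :=
  I * (((totExp k n₁ n₂ i).1 : ℂ) * α + ((totExp k n₁ n₂ i).2 : ℂ) * δ)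

/-- (Ported verbatim from the HodgeCMPerL package; no docstring in the source.) -/
theorem locChar_eq (k : PlaceKind) (n₁ n₂ : ℤ) (α δ : ℝ) (i : locIdx k) (s : ℝ) :
    locChar k n₁ n₂ α δ i s =
      (((circleCurve α δ s).1 : Circle) : ℂ) ^ (totExp k n₁ n₂ i).1 *
        (((circleCurve α δ s).2 : Circle) : ℂ) ^ (totExp k n₁ n₂ i).2 := by
  rw [locChar, coe_pinnedVac, totExp, zpow_add₀ (Circle.coe_ne_zero _), zpow_add₀ (Circle.coe_ne_zero _)]
  ring

/-- (Ported verbatim from the HodgeCMPerL package; no docstring in the source.) -/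
theorem locChar_zero (k : PlaceKind) (n₁ n₂ : ℤ) (α δ : ℝ) (i : locIdx k) : locChar k n₁ n₂ α δ i 0 = 1 := by
  rw [locChar_eq, circleCurve_zero]
  simp

/-- **(KERNEL)** the pinned character along `circleCurve α δ` is differentiable at `0` with derivative the frequency. -/
theorem hasDerivAt_locChar (k : PlaceKind) (n₁ n₂ : ℤ) (α δ : ℝ) (i : locIdx k) :
    HasDerivAt (locChar k n₁ n₂ α δ i) (locFreq k n₁ n₂ α δ i) 0 := by
  have h := hasDerivAt_circleMonomial α δ (totExp k n₁ n₂ i).1 (totExp k n₁ n₂ i).2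
  refine (h.congr_of_eventuallyEq (Filter.Eventually.of_forall fun s => ?_))
  exact locChar_eq k n₁ n₂ α δ i s

/-- The eigen-lemma of §2 for the pinned datum, along the curve: `ω_k(u(s)) x_i = locChar(s) • x_i`. -/
theorem locFam_eigen_pinned (k : PlaceKind) (n₁ n₂ : ℤ) (α δ : ℝ) (i : locIdx k) (s : ℝ) :
    (printLoc lam hlam (pinnedVac k n₁ n₂) k).ω
        ((kindCoord lam hlam (pinnedVac k n₁ n₂) k).symm (circleCurve α δ s)) (locFam lam hlam (pinnedVac k n₁ n₂) k i) =
      locChar k n₁ n₂ α δ i s • locFam lam hlam (pinnedVac k n₁ n₂) k i :=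
  locFam_eigen lam hlam (pinnedVac k n₁ n₂) k i (circleCurve α δ s)

/-- **The local generator at `Σ₁₂` in PRINTED form (KERNEL)**: for the torus velocity `(α, δ)` and pinned exponents
`(n₁, n₂)`, `iα·ρ(1⊗E₀₀) + iδ·ρ(1⊗E₁₁) + i(δ(3/2 − n₂) − α(3/2 + n₁))·1` on `ℂ[P]` — a ℂ-combination of Adams's printed
diagonal `𝔲(1,1)_ℂ` operators `printedU11M λ (0,0), (1,1)` (pv12-g6) and the identity. -/
def genSigma (α δ : ℝ) (n₁ n₂ : ℤ) : ↥kappaPartM →ₗ[ℂ] ↥kappaPartM :=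
  (I * α : ℂ) • printedU11M lam (0, 0) + (I * δ : ℂ) • printedU11M lam (1, 1) +
    (I * (δ * (3 / 2 - n₂) - α * (3 / 2 + n₁)) : ℂ) • LinearMap.id

/-- The `Σ₁₂`-frequency of `P^n` in closed form: `i(n(α − δ) − n₁α − n₂δ)`. -/
theorem locFreq_sigma (n₁ n₂ : ℤ) (α δ : ℝ) (n : ℕ) :
    locFreq .sigma n₁ n₂ α δ n = I * ((n : ℂ) * (α - δ) - n₁ * α - n₂ * δ) := by
  simp only [locFreq, totExp, vacExp, locWt]
  push_cast
  ring

/-- Its eigenvalue on `P^n` is the `Σ₁₂`-frequency (KERNEL: pv12-g6 `torusW₀_P_pow`, `torusW₁_P_pow`). -/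
theorem genSigma_P_pow (α δ : ℝ) (n₁ n₂ : ℤ) (n : ℕ) :
    genSigma lam α δ n₁ n₂ ⟨P ^ n, P_pow_mem_kappaPartM n⟩ =
      locFreq .sigma n₁ n₂ α δ n • (⟨P ^ n, P_pow_mem_kappaPartM n⟩ : ↥kappaPartM) := by
  rw [locFreq_sigma]
  apply Subtype.ext
  have h0 := torusW₀_P_pow lam n
  have h1 := torusW₁_P_pow lam n
  simp only [genSigma, LinearMap.add_apply, LinearMap.smul_apply, LinearMap.id_apply, Submodule.coe_add,
    Submodule.coe_smul, printedU11M_coe, printedU11_apply, h0, h1, smul_smul, ← add_smul]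
  refine congrArg (fun c : ℂ => c • (P ^ n : MixedModel)) ?_
  ring

variable (vac : Circle × Circle →* Circle)

/-- The local generator of kind `k`: `genSigma` at `Σ₁₂`, the scalar frequency at the line places `D₁₂`, `ι₁`. -/
def locGen (n₁ n₂ : ℤ) (α δ : ℝ) :
    (k : PlaceKind) → ((printLoc lam hlam vac k).M →ₗ[ℂ] (printLoc lam hlam vac k).M)
  | .sigma => genSigma lam α δ n₁ n₂
  | .delta => (I * (((-n₁ : ℤ) : ℂ) * α + ((-n₂ : ℤ) : ℂ) * δ)) • LinearMap.id
  | .iota => (I * (((-n₁ : ℤ) : ℂ) * α + ((-n₂ : ℤ) : ℂ) * δ)) • LinearMap.id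
  | .sigmaSwap => genSigma lam δ α n₂ n₁

/-- (Ported verbatim from the HodgeCMPerL package; no docstring in the source.) -/
theorem locGen_delta_apply (n₁ n₂ : ℤ) (α δ : ℝ) (φ : ↥kappaPartE) :
    locGen lam hlam vac n₁ n₂ α δ .delta φ = locFreq .delta n₁ n₂ α δ φ • φ := by
  show (I * (((-n₁ : ℤ) : ℂ) * α + ((-n₂ : ℤ) : ℂ) * δ)) • φ = _
  congr 1
  simp only [locFreq, totExp, vacExp, locWt, add_zero]

/-- (Ported verbatim from the HodgeCMPerL package; no docstring in the source.) -/
theorem locGen_iota_apply (n₁ n₂ : ℤ) (α δ : ℝ) (φ : ↥kappaPartI) :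
    locGen lam hlam vac n₁ n₂ α δ .iota φ = locFreq .iota n₁ n₂ α δ φ • φ := by
  show (I * (((-n₁ : ℤ) : ℂ) * α + ((-n₂ : ℤ) : ℂ) * δ)) • φ = _
  congr 1
  simp only [locFreq, totExp, vacExp, locWt, sub_add_cancel]

/-- The swapped `Σ₁₂`-frequency of `P^n` in closed form (T12): `i(n(δ − α) − n₁α − n₂δ)`. -/
theorem locFreq_sigmaSwap (n₁ n₂ : ℤ) (α δ : ℝ) (n : ℕ) :
    locFreq .sigmaSwap n₁ n₂ α δ n = I * ((n : ℂ) * (δ - α) - n₁ * α - n₂ * δ) := by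
  simp only [locFreq, totExp, vacExp, locWt]
  push_cast
  ring

/-- At a swapped `Σ₁₂` place the local generator is `genSigma` with the two torus velocities and the two exponents
exchanged (T12: the model's first variable follows `W₂`), and it is diagonal on `P^n` with the swapped frequency. -/
theorem locGen_sigmaSwap_apply (n₁ n₂ : ℤ) (α δ : ℝ) (n : ℕ) :
    locGen lam hlam vac n₁ n₂ α δ .sigmaSwap (locFam lam hlam vac .sigmaSwap n) =
      locFreq .sigmaSwap n₁ n₂ α δ n • locFam lam hlam vac .sigmaSwap n := by
  show genSigma lam δ α n₂ n₁ ⟨P ^ n, P_pow_mem_kappaPartM n⟩ =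
    locFreq .sigmaSwap n₁ n₂ α δ n • (⟨P ^ n, P_pow_mem_kappaPartM n⟩ : ↥kappaPartM)
  rw [genSigma_P_pow, locFreq_sigma, locFreq_sigmaSwap]
  congr 1
  ring

/-- **(KERNEL)** the local generator is diagonal on the family with the frequencies as eigenvalues. -/
theorem locGen_locFam (n₁ n₂ : ℤ) (α δ : ℝ) : ∀ (k : PlaceKind) (i : locIdx k),
    locGen lam hlam vac n₁ n₂ α δ k (locFam lam hlam vac k i) = locFreq k n₁ n₂ α δ i • locFam lam hlam vac k i := by
  intro k
  cases k with
  | sigma => exact fun n => genSigma_P_pow lam α δ n₁ n₂ n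
  | delta => exact fun φ => locGen_delta_apply lam hlam vac n₁ n₂ α δ φ
  | iota => exact fun φ => locGen_iota_apply lam hlam vac n₁ n₂ α δ φ
  | sigmaSwap => exact fun n => locGen_sigmaSwap_apply lam hlam vac n₁ n₂ α δ n

end Pinned
/-! ## 4. Global assembly over the printed places with pinned vacuum characters -/

section Global

variable (RP : Type) [Fintype RP] [DecidableEq RP] (kind : RP → PlaceKind) (lam : RP → ℂ) (hlam : ∀ b, lam b ≠ 0)
  (m₁ m₂ : RP → ℤ)

/-- The printed `FockPlaces` of PerL Lemma 4.1 (pv12-g7 `printPlaces`) with PINNED vacuum characters (pv11-g8 `pinnedVacs`). -/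
abbrev pinnedPlaces : FockPlaces := printPlaces RP kind lam hlam (pinnedVacs kind m₁ m₂)

/-- The local Fock module at the real place `b` (`= ((pinnedPlaces …).loc b).M` by `rfl`, pv12-g7 `printPlaces_loc`). -/
abbrev locM (b : RP) : Type := (printLoc (lam b) (hlam b) (pinnedVacs kind m₁ m₂ b) (kind b)).M

/-- (Ported verbatim from the HodgeCMPerL package; no docstring in the source.) -/
theorem pinnedPlaces_loc (b : RP) :
    (pinnedPlaces RP kind lam hlam m₁ m₂).loc b = printLoc (lam b) (hlam b) (pinnedVacs kind m₁ m₂ b) (kind b) := rfl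

variable (α δ : RP → ℝ)

/-- The one-parameter subgroup of the place torus `Π_b U(W_{1,b}) × U(W_{2,b})` with velocity `(α_b, δ_b)` at each place. -/
def torusCurve (s : ℝ) : (pinnedPlaces RP kind lam hlam m₁ m₂).Tg := fun b =>
  (kindCoord (lam b) (hlam b) (pinnedVacs kind m₁ m₂ b) (kind b)).symm (circleCurve (α b) (δ b) s)

/-- (Ported verbatim from the HodgeCMPerL package; no docstring in the source.) -/
theorem torusCurve_apply (s : ℝ) (b : RP) :
    torusCurve RP kind lam hlam m₁ m₂ α δ s b =
      (kindCoord (lam b) (hlam b) (pinnedVacs kind m₁ m₂ b) (kind b)).symm (circleCurve (α b) (δ b) s) := rfl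

/-- **The infinitesimal generator of the torus direction `(α, δ)` on `𝓕^κ_∞` (KERNEL, explicit)**: the sum over the real
places of the local generators `locGen` in their slots (pv12-g2 `Fock.slot`); its type is `(pinnedPlaces …).F →ₗ[ℂ] _` by `rfl`. -/
def torusGen : (⨂[ℂ] b, locM RP kind lam hlam m₁ m₂ b) →ₗ[ℂ] ⨂[ℂ] b, locM RP kind lam hlam m₁ m₂ b :=
  ∑ b, slot b (locGen (lam b) (hlam b) (pinnedVacs kind m₁ m₂ b) (m₁ b) (m₂ b) (α b) (δ b) (kind b))


-- port_pkg: scope closed for this part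
end Global
end PrintDict
end Fock
end PerL34
end HodgeCM
end
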